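import Summits.CriticalPhenomena.CardyFormulaZ2.Theorems.CardyRotToConfR2SymmetryUpgrade.Negative.SurgFatMarkovKernel
import Summits.CriticalPhenomena.CardyFormulaZ2.Theorems.CardyRotToConfR2SymmetryUpgradeFatSurgeryLocalStop
import Summits.CriticalPhenomena.CardyFormulaZ2.Theorems.CardyRotToConfR2SymmetryUpgradeFatSurgeryChordal
import Summits.CriticalPhenomena.CardyFormulaZ2.Theorems.CardyRotToConfR2SymmetryUpgradeMarkovPrefix
import Literature.Probability.RandomPlanarGeometry.ChordalKSCondition
import HarnessLib

/-!
# Markov property of the fat-germ surgery, chord phase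
# (line `germ-label-transport`, crux `CardyRotToConfR2SymmetryUpgrade`, stmt-CriticalPhenomena-0698)

For a firing Dobrushin domain `D` and a closed set `F` MET by the surgery chord `fireChord D`
(first at the parameter `sg`), the surgery law `J D = Negative.fatSurgery S D` is stopped at the
deterministic class `p₀ = mk ((fireChord D).stopAt F)` almost surely
(`FatSurgeryLocal.ae_stopAt_fatSurgery_eq`), so the Markov disintegration at `F` reduces to the
identity `K D p₀ = (J D).map (startFrom F)` for the candidate kernel `K = Negative.surgExt S Q`.
We prove that identity by cases: `sg = 0` (the past is trivial, `K D (const a) = J D` and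
`startFrom F = id` a.s.); `0 < sg < 1` (a slit configuration: `K` is `(J D).map (startFrom {z})`
by `surgKernel_of_slit`, and `startFrom {z} = startFrom F` a.s. since both first hits happen at
the chord point `z = fireChord D sg`); `sg = 1` (the whole chord: if the landing point `q ≠ b` the
configuration is the Jordan crosscut domain `E`, which does not re-fire, so `K = S E`, while
`startFrom F ∘ firePrefix D = id` a.s.; if `q = b` both sides are `δ_{const b}`). We also record
the generic reduction `markov_of_ae_stopAt_eq` and the Dirac computations used when the chord
misses `F`.
-/

noncomputable section

open Set Filter Topology Metric MeasureTheory
open scoped unitInterval ENNReal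

namespace Summit.CriticalPhenomena.CardyFormulaZ2.Theorems.CardyRotToConfR2SymmetryUpgrade

open Literature.Probability.RandomPlanarGeometry Literature.Probability.RandomPlanarGeometry.ChordalFamily
open Summit.CriticalPhenomena.CardyFormulaZ2.Theorems.CardyRotToConfR2SymmetryUpgrade.Negative

namespace MarkovChord

/-! ### Generic: a deterministic stop reduces the Markov identity to one kernel value -/

/-- **Markov identity from a deterministic stop.** If `μ`-a.s. the class stopped at the closed set
`F` is the fixed class `p₀`, and the kernel value at `p₀` is the law of the restarted class, then
`μ` disintegrates along `(stopAt F, startFrom F)` through the kernel. [folklore] -/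
theorem markov_of_ae_stopAt_eq {μ : Measure (CurveClass ℂ)} [IsProbabilityMeasure μ] {F : Set ℂ}
    (hF : IsClosed F) {p₀ : CurveClass ℂ} (hstop : ∀ᵐ γ ∂μ, CurveClass.stopAt F γ = p₀)
    {K : CurveClass ℂ → Measure (CurveClass ℂ)} (hK : K p₀ = μ.map (CurveClass.startFrom F))
    {A B : Set (CurveClass ℂ)} (hB : MeasurableSet B) :
    μ (CurveClass.stopAt F ⁻¹' A ∩ CurveClass.startFrom F ⁻¹' B) =
      ∫⁻ γ in CurveClass.stopAt F ⁻¹' A, K (CurveClass.stopAt F γ) B ∂μ := by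
  have hint : ∫⁻ γ in CurveClass.stopAt F ⁻¹' A, K (CurveClass.stopAt F γ) B ∂μ =
      ∫⁻ _γ in CurveClass.stopAt F ⁻¹' A, K p₀ B ∂μ := by
    refine lintegral_congr_ae (ae_restrict_of_ae ?_)
    filter_upwards [hstop] with γ hγ
    rw [hγ]
  rw [hint, setLIntegral_const]
  by_cases hp : p₀ ∈ A
  · rw [FatSurgeryLocal.measure_preimage_stopAt_of_ae_of_mem hstop hp, mul_one, hK,
      Measure.map_apply (measurable_startFrom hF) hB]
    refine measure_congr (Filter.eventuallyEq_set.2 ?_)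
    filter_upwards [hstop] with γ hγ
    simp only [mem_inter_iff, mem_preimage, hγ, hp, true_and]
  · rw [FatSurgeryLocal.measure_preimage_stopAt_of_ae_of_notMem hstop hp, mul_zero]
    exact measure_mono_null inter_subset_left
      (FatSurgeryLocal.measure_preimage_stopAt_of_ae_of_notMem hstop hp)

/-! ### Configurations that are neither Jordan nor slit -/

/-- No Dobrushin configuration has equal marks. [folklore] -/
theorem not_isJordanConfig_self (V : Set ℂ) (b : ℂ) : ¬ IsJordanConfig V b b := by
  rintro ⟨D₂, -, h0, h1⟩
  exact absurd (D₂.pt_injective (h0.trans h1.symm)) (by decide)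

/-- No slit configuration has its tip at the target (open chord points are interior points, the
target is a boundary point). [folklore] -/
theorem not_isSlitConfig_self (V : Set ℂ) (b : ℂ) : ¬ IsSlitConfig V b b := by
  rintro ⟨D₁, s, h, hb, hs0, hs1, hz, -⟩
  have hmem : fireChord D₁ s ∈ D₁.carrier := fireChord_mem_carrier h hs0 hs1
  rw [hz, ← hb] at hmem
  have hfr := D₁.pt_mem_frontier 1
  rw [D₁.isOpen.frontier_eq] at hfr
  exact hfr.2 hmem

variable {S : ChordalFamily} {Q : DobrushinDomain → CurveClass ℂ → Measure (CurveClass ℂ)}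
  {D : DobrushinDomain} {F : Set ℂ}

/-- **Kernel at the full chord landing at `b`**: `δ_{const b}`. [folklore] -/
theorem surgExt_chord_of_eq (hq : firePt D = D.pt 1) :
    surgExt S Q D (CurveClass.mk (fireChord D)) =
      Measure.dirac (CurveClass.mk (Curve.const (D.pt 1))) := by
  have ht : (CurveClass.mk (fireChord D)).target = D.pt 1 := by
    rw [CurveClass.target_mk, target_fireChord, hq]
  rw [surgExt, ht]
  exact surgKernel_of_target (not_isJordanConfig_self _ _) (not_isSlitConfig_self _ _) rfl

/-- **Restart law of the Dirac chord past the chord**: if the chord meets `F` at the latest at its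
endpoint (hitting parameter `1`), the chord restarted at `F` is the constant class at the landing
point. [folklore] -/
theorem map_startFrom_dirac_chord (hF : IsClosed F) (h1 : (fireChord D).hitParam F = 1) :
    (Measure.dirac (CurveClass.mk (fireChord D))).map (CurveClass.startFrom F) =
      Measure.dirac (CurveClass.mk (Curve.const (firePt D))) := by
  rw [Measure.map_dirac' (measurable_startFrom hF), CurveClass.startFrom_mk_holds F hF,
    Curve.startFrom_eq_const_of_hitParam_eq_one h1, Curve.target_def]
  show Measure.dirac (CurveClass.mk (Curve.const (fireChord D).target)) = _
  rw [target_fireChord]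

/-! ### The identity `K D p₀ = (J D).map (startFrom F)` when the chord meets `F` -/

section Hit

variable (hS : IsLocalMarkovChordalFamily S) (h : Fires D.carrier (D.pt 0)) (hF : IsClosed F)
include hS h hF

omit h hF in
/-- Case `sg = 0`: `a ∈ F`, the past is trivial and restarting does nothing. [folklore] -/
theorem surgExt_eq_map_of_source_mem (ha : D.pt 0 ∈ F) :
    surgExt S Q D (CurveClass.mk ((fireChord D).stopAt F)) =
      (fatSurgery S D).map (CurveClass.startFrom F) := by
  have hsrc : (fireChord D).source ∈ F := by rw [source_fireChord]; exact ha
  rw [Curve.stopAt_eq_const_of_source_mem hsrc, source_fireChord, surgExt_initial hS.isLocal]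
  symm
  calc (fatSurgery S D).map (CurveClass.startFrom F)
      = (fatSurgery S D).map id := by
        refine Measure.map_congr ?_
        filter_upwards [(FatSurgeryChordal.isChordal_fatSurgery hS.isChordal D).2] with γ hγ
        exact CurveClass.startFrom_eq_self_of_source_mem (by rw [hγ.1]; exact ha)
    _ = fatSurgery S D := Measure.map_id

omit hS h hF in
/-- The chord stopped at `F`, when `F` is first met at `sg`, is the sub-chord of parameter
`sg · fireExit D`; its class has trace `[a, z]`, `z = fireChord D sg`, and tip `z`. [folklore] -/
theorem stopAt_fireChord_eq {sg : I} (hsg : (fireChord D).hitParam F = sg) :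
    (fireChord D).stopAt F = chordCurve (D.pt 0) (fireTip D) ((sg : ℝ) * fireExit D) := by
  refine Curve.ext (ContinuousMap.ext fun s => ?_)
  show (fireChord D).stopAt F s = chordCurve (D.pt 0) (fireTip D) ((sg : ℝ) * fireExit D) s
  have hmem : (sg : ℝ) * s ∈ Icc (0 : ℝ) 1 :=
    ⟨mul_nonneg sg.2.1 s.2.1, mul_le_one₀ sg.2.2 s.2.1 s.2.2⟩
  rw [Curve.stopAt_apply, hsg, projIcc_of_mem _ hmem, fireChord_apply]
  show rayPt (D.pt 0) (fireTip D) (((sg : ℝ) * s) * fireExit D) =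
    rayPt (D.pt 0) (fireTip D) ((s : ℝ) * ((sg : ℝ) * fireExit D))
  ring_nf

/-- Case `0 < sg < 1`: a slit configuration; the kernel is `(J D).map (startFrom {z})` and the
two restarting maps agree `J D`-a.s. [folklore] -/
theorem surgExt_eq_map_of_mid {sg : I} (hs0 : 0 < (sg : ℝ)) (hs1 : (sg : ℝ) < 1)
    (hsg : (fireChord D).hitParam F = sg)
    (hmid : ∀ ξ : CurveClass ℂ, ξ.source = firePt D →
      CurveClass.startFrom F (firePrefix D ξ) = CurveClass.startFrom {fireChord D sg} (firePrefix D ξ)) :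
    surgExt S Q D (CurveClass.mk ((fireChord D).stopAt F)) =
      (fatSurgery S D).map (CurveClass.startFrom F) := by
  set z := fireChord D sg with hz
  have hne := fireTip_ne h
  -- the stopped chord: trace `[a, z]`, tip `z`
  have hstop := stopAt_fireChord_eq hsg
  have hzray : rayPt (D.pt 0) (fireTip D) ((sg : ℝ) * fireExit D) = z := by
    rw [hz, fireChord_apply]
  have hran : (CurveClass.mk ((fireChord D).stopAt F)).range = segment ℝ (D.pt 0) z := by
    rw [CurveClass.range_mk, hstop, range_chordCurve, hzray]
  have htgt : (CurveClass.mk ((fireChord D).stopAt F)).target = z := by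
    rw [CurveClass.target_mk, hstop, target_chordCurve, hzray]
  have hza : D.pt 0 ≠ z := (fireChord_ne_pt_zero h hs0).symm
  have hrem : remainingDomain D (CurveClass.mk ((fireChord D).stopAt F)) =
      D.carrier \ segment ℝ (D.pt 0) z :=
    remainingDomain_eq_diff_segment D _ hran hza (segment_fireChord_diff_subset h hs1)
  rw [surgExt, htgt, surgKernel_of_slit hS.isLocal h hs0 hs1 rfl rfl hrem]
  -- `startFrom {z} = startFrom F` almost surely under `J D`
  have hchord : (fireChord D).startFrom {z} = (fireChord D).startFrom F := by
    refine startFrom_eq_of_hitParam_eq ?_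
    rw [hsg]
    exact FatSurgeryLocal.hitParam_eq_of_forall_lt
      (fun t ht heq => ht.ne (congrArg (fun u : I => (u : ℝ)) (injective_fireChord h heq)))
      (mem_singleton _)
  have hae : ∀ᵐ γ ∂(fatSurgery S D),
      CurveClass.startFrom {z} γ = CurveClass.startFrom F γ := by
    by_cases hq : firePt D = D.pt 1
    · rw [fatSurgery_of_eq h hq, ae_dirac_eq, eventually_pure,
        CurveClass.startFrom_mk_holds _ isClosed_singleton, CurveClass.startFrom_mk_holds F hF, hchord]
    · rw [fatSurgery_of_ne h hq]
      have hmeas : MeasurableSet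
          {γ : CurveClass ℂ | CurveClass.startFrom {z} γ = CurveClass.startFrom F γ} :=
        measurableSet_eq_fun (measurable_startFrom isClosed_singleton) (measurable_startFrom hF)
      refine (ae_map_iff (measurable_firePrefix D).aemeasurable hmeas).2 ?_
      filter_upwards [(hS.isChordal (fireDom h hq)).2] with ξ hξ
      rw [pt_zero_fireDom] at hξ
      exact (hmid ξ hξ.1).symm
  exact Measure.map_congr hae

/-- Case `sg = 1`: the whole chord is the past; at the landing point the configuration is the
crosscut domain (which does not re-fire) or the target. [folklore] -/
theorem surgExt_eq_map_of_one (h1 : (fireChord D).hitParam F = 1)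
    (hjunction : firePt D ≠ D.pt 1 → ∀ ξ : CurveClass ℂ, ξ.source = firePt D →
      CurveClass.startFrom F (firePrefix D ξ) = ξ) :
    surgExt S Q D (CurveClass.mk ((fireChord D).stopAt F)) =
      (fatSurgery S D).map (CurveClass.startFrom F) := by
  rw [Curve.stopAt_eq_self_of_hitParam_eq_one h1]
  by_cases hq : firePt D = D.pt 1
  · rw [surgExt_chord_of_eq hq, fatSurgery_of_eq h hq, map_startFrom_dirac_chord hF h1, hq]
  · -- Jordan configuration `(E; q, b)`, `E` does not fire
    have hrem := remainingDomain_fireChord h hq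
    have htgt : (CurveClass.mk (fireChord D)).target = (fireDom h hq).pt 0 := by
      rw [CurveClass.target_mk, target_fireChord, pt_zero_fireDom]
    rw [surgExt, surgKernel_of_jordan hS.isLocal hrem.symm htgt.symm (pt_one_fireDom h hq),
      fatSurgery_of_not_fires (by rw [pt_zero_fireDom]; exact not_fires_fireDom h hq),
      fatSurgery_of_ne h hq, Measure.map_map (measurable_startFrom hF) (measurable_firePrefix D)]
    symm
    calc (S (fireDom h hq)).map (CurveClass.startFrom F ∘ firePrefix D)
        = (S (fireDom h hq)).map id := by
          refine Measure.map_congr ?_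
          filter_upwards [(hS.isChordal (fireDom h hq)).2] with ξ hξ
          rw [pt_zero_fireDom] at hξ
          exact hjunction hq ξ hξ.1
      _ = S (fireDom h hq) := Measure.map_id

/-- **The kernel at the deterministic stopped chord is the restart law**: if the chord meets the
closed set `F`, then `K D (mk ((fireChord D).stopAt F)) = (J D).map (startFrom F)` for the
candidate kernel `K = Negative.surgExt S Q` and the surgery law `J D = Negative.fatSurgery S D`.
[folklore] -/
theorem surgExt_stopAt_chord_eq_map (hhit : ∃ t, fireChord D t ∈ F) :
    surgExt S Q D (CurveClass.mk ((fireChord D).stopAt F)) =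
      (fatSurgery S D).map (CurveClass.startFrom F) := by
  set sg : I := ⟨(fireChord D).hitParam F, (fireChord D).hitParam_mem_Icc F⟩ with hsgdef
  have hsg : (fireChord D).hitParam F = sg := rfl
  have hmem : fireChord D sg ∈ F := Curve.apply_hitParam_mem hF hhit
  rcases eq_or_lt_of_le sg.2.1 with hs0 | hs0
  · -- `sg = 0`: `a ∈ F`
    have ha : D.pt 0 ∈ F := by
      have : sg = 0 := Subtype.ext hs0.symm
      rw [this] at hmem
      rwa [← Curve.source_def, source_fireChord] at hmem
    exact surgExt_eq_map_of_source_mem hS ha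
  rcases eq_or_lt_of_le sg.2.2 with hs1 | hs1
  · -- `sg = 1`
    refine surgExt_eq_map_of_one hS h hF (by rw [hsg, hs1]) fun _ ξ hξ => ?_
    have hlt : ∀ t : I, (t : ℝ) < 1 → fireChord D t ∉ F := fun t ht =>
      Curve.notMem_of_lt_hitParam (by rw [hsg, hs1]; exact ht)
    have hqF : firePt D ∈ F := by
      have : sg = 1 := Subtype.ext hs1
      rw [this] at hmem
      rwa [← Curve.target_def, target_fireChord] at hmem
    exact (stub_fatSurgeryMarkovPrefix).2.1 D F hF h hlt hqF ξ hξ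
  · -- `0 < sg < 1`
    exact surgExt_eq_map_of_mid hS h hF hs0 hs1 hsg fun ξ hξ =>
      (stub_fatSurgeryMarkovPrefix).2.2.2 D F hF h sg hs0 hs1 hsg hmem ξ hξ

end Hit

end MarkovChord

open MarkovChord in
/-- **Chord phase of the Markov property of the fat surgery** (helper of
`stub_fatSurgeryMarkovCore`): for an admissible `S`, any candidate kernel data `Q`, a firing
domain `D` and a closed set `F` met by the surgery chord, the surgery's candidate kernel at the
deterministic stopped chord `mk ((fireChord D).stopAt F)` is the law of the surgery curve
restarted at `F`. [folklore] -/
theorem stub_fatSurgeryMarkovChord : ∀ (S : ChordalFamily) (Q : DobrushinDomain → CurveClass ℂ → MeasureTheory.Measure (CurveClass ℂ)) (D : DobrushinDomain) (F : Set ℂ), IsLocalMarkovChordalFamily S → Summit.CriticalPhenomena.CardyFormulaZ2.Theorems.CardyRotToConfR2SymmetryUpgrade.Negative.Fires D.carrier (D.pt 0) → IsClosed F → (∃ t : unitInterval, Summit.CriticalPhenomena.CardyFormulaZ2.Theorems.CardyRotToConfR2SymmetryUpgrade.Negative.fireChord D t ∈ F) → Summit.CriticalPhenomena.CardyFormulaZ2.Theorems.CardyRotToConfR2SymmetryUpgrade.Negative.surgExt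 S Q D (CurveClass.mk ((Summit.CriticalPhenomena.CardyFormulaZ2.Theorems.CardyRotToConfR2SymmetryUpgrade.Negative.fireChord D).stopAt F)) = (Summit.CriticalPhenomena.CardyFormulaZ2.Theorems.CardyRotToConfR2SymmetryUpgrade.Negative.fatSurgery S D).map (CurveClass.startFrom F) :=
  fun _ _ _ _ hS h hF hhit => surgExt_stopAt_chord_eq_map hS h hF hhit

end Summit.CriticalPhenomena.CardyFormulaZ2.Theorems.CardyRotToConfR2SymmetryUpgrade

end
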